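import Summits.CriticalPhenomena.PercolationContinuityZ3.Theorems.PercNearOneGluingNoHeavyLowerTailSahiLatinZeroBottomTwoBlockCertDefs

/-!
# `NoHeavyLowerTail` (crux stmt-CriticalPhenomena-4575), Sahi programme (prim-master-conj gen 52): the two-block certificate — FINITE CHECK, part 3
# (kernel `decide` over the sorted type pairs `(a,b)` ∈ [(1, 3), (1, 6)])

Support file (`--supports stmt-CriticalPhenomena-4575`; proofs by `decide` (kernel) only, no `sorry`, standard axioms).  For the sorted `U`-type triple
`sorted3 a` and sorted `V`-type triple `sorted3 b` it checks, for all `512` bit matrices, that the symmetrised difference `phi36F` of the `Ψ`-integrand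
and the certificate is nonnegative on admissible configurations (`…TwoBlockCertDefs`). [this work]
-/

namespace Summit.CriticalPhenomena.PercolationContinuityZ3.Theorems.SahiLatin.TwoBlock

/-- Finite check for the sorted type pair `(1, 3)`. [this work] -/
theorem phi36_chk_1_3 : ∀ m : Fin 512, adm (srtCfg 1 3 m) = true → 0 ≤ phi36F (srtCfg 1 3 m) := by decide +kernel

/-- Finite check for the sorted type pair `(1, 6)`. [this work] -/
theorem phi36_chk_1_6 : ∀ m : Fin 512, adm (srtCfg 1 6 m) = true → 0 ≤ phi36F (srtCfg 1 6 m) := by decide +kernel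

end Summit.CriticalPhenomena.PercolationContinuityZ3.Theorems.SahiLatin.TwoBlock
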